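import Summits.HodgeConjecture.HodgeConjecture.Theorems.Ring2AbelianAllAndreKleimanClasses
import HarnessLib

/-!
# Ring 2 · sub-cell AbelianAll (ALL ABELIAN VARIETIES), André axis, part XXXIX-a — THE PULL-BACK OF A TOP CLASS ALONG THE GROUP LAW
# ACTS AS `(-1)^{deg} · c`: for `Ω ∈ H^{2g}(A)` and `Γ = m^*Ω ∈ H^{2g}(A × A)`, `[Γ]_* x = (-1)^d c · x` on every `Hᵈ(A(ℂ); ℂ)`

HONEST FRAMING (page 1, verbatim): **research route, not a corollary; conditional on HC_CM plus one named
minimal statement.** Cell line: research route conditional on HC_CM; not a corollary; Q11.4-sentence-2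
already refuted in dim ≥ 3. Nothing in this file proves a case of the Hodge conjecture; `HC_CM` does not occur in this file.

Gen-31 file of the `ab-andre-2` seat (cell `pub-hodge-ring2`, sub-cell AbelianAll = ALL abelian varieties). This is the first of the
three files that discharge the Kleiman identities of ALL middle Lefschetz blocks (hypothesis `hF` of part XXXVIII-j) by SCHOLL'S FORMULA
[Scholl 1994, (5.9.1); Milne 1999, Rem. 5.11]: the inverse of `L^{g-i} : Hⁱ(A) ⥲ H^{2g-i}(A)` is the correspondence
`f_i = Σ_j 1/(j!(g-i+j)!(i-2j)!) pr₁^*θʲ · pr₂^*θʲ · ℓ^{i-2j}` — and `f_i ∘ L^{g-i}` is the weight-`i` component of the correspondence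
`[m^*θ^g]_*`, `m` the group law. THIS FILE computes `[m^*Ω]_*` for ANY top-degree class `Ω`.

## What is proved (sorry-free; no definition, no named fact)

For a complex abelian variety `A` with `hA : IsSmoothProjective g A.X`, a class `Ω ∈ H^{2g}(A(ℂ); ℂ)` and `Γ := m^*Ω ∈ H^{2g}((A × A)(ℂ); ℂ)`
(`[Γ]_* = corrAction`, Voisin II (10.7): `[Γ]_* x = pr_{1*}(pr₂^* x ∪ Γ)`):

* `complexBetti_map_mul_one_apply` — `m^* v = pr₁^* v + pr₂^* v` on `H¹(A(ℂ); ℂ)` (Mumford §1 (2), complex coefficients).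
* `cupProduct_top_one_eq_zero` — `Ω ∪ v = 0` (`H^{2g+1}(A) = 0`).
* **`corrAction_pullMul_top_cup_one`** — THE COMMUTATION RULE `[m^*Ω]_*(v ∪ w) = -(v ∪ [m^*Ω]_* w)` for `v ∈ H¹`, `w ∈ Hᵈ`:
  `pr₂^* v = m^* v - pr₁^* v`, the `m^* v`-term dies against `m^*Ω` (`m^*(Ω ∪ v) = 0`), the `pr₁^* v`-term comes out by the projection formula.
* **`exists_corrAction_pullMul_top_eq_smul`** — hence `∃ c, ∀ d x, [m^*Ω]_* x = ((-1)^d c) · x` (`c` = the value on `1 ∈ H⁰`; induction over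
  cup products of degree-one classes, which span `H^•(A(ℂ); ℂ) = ⋀^• H¹`). In print: `m^*[pt] = [Γ_{[-1]}]`, `[-1]^* = (-1)^{deg}`.

## Documentary interface — PRINT / LEAN / GAP

PRINT: [MumfordAV1970, §1 (2)–(4)] (`m^*` additive on `H¹`, `H^• = ⋀^• H¹`); [Scholl1994ClassicalMotives, (5.9.1)]; [Milne1999LefschetzClasses,
Rem. 5.11]; [VoisinHodgeII2003, (10.7)]; [Fulton1998, Prop. 1.7 and §16.1]. LEAN: the displayed theorems, fact-free. GAP: none (service file for
parts XXXIX-b/c: the weight-`i` component of `[m^*θ^g]_*` is Scholl's `f_i ∘ L^{g-i}`).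
-/

noncomputable section

set_option linter.dupNamespace false

namespace Summit.HodgeConjecture.HodgeConjecture.Ring2.AbelianAll

open CategoryTheory CategoryTheory.Limits AlgebraicGeometry MonoidalCategory CartesianMonoidalCategory
open Literature.AlgebraicGeometry Literature.AlgebraicGeometry.Motives
open Literature.AlgebraicGeometry.HodgeTheory
open Literature.AlgebraicTopology.SingularHomology (singularCohomology cupProduct cupProduct_map cupProduct_one one_cupProduct
  cupProduct_assoc cupProduct_gradedComm_holds cupPowOne cupPowOne_zero cupPowOne_succ)
open Summit.HodgeConjecture.CorCM.Model
open scoped MonObj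

section TopClass

variable (A : AbelianVariety ℂ) {g : ℕ}

/-- **`m^* v = pr₁^* v + pr₂^* v` on `H¹(A(ℂ); ℂ)`** (the group law acts additively on degree-one cohomology; complex
coefficients: `m = pr₁ · pr₂` in `Hom(A × A, A)`, pointwise products act additively on `H¹(–; ℂ)` of the path-connected group `A(ℂ)`).
[cite: MumfordAV1970, §1 (2)] [cite: HatcherAT2002, §3.1 Thm. 3.2 and p. 198] -/
theorem complexBetti_map_mul_one_apply (v : complexBetti A.X 1) :
    complexBetti.map μ[A.X] 1 v = complexBetti.map (fst A.X A.X) 1 v + complexBetti.map (snd A.X A.X) 1 v := by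
  haveI : PathConnectedSpace (ComplexPoints (A.X ⊗ A.X)) := AbelianVariety.Points.instPathConnectedSpace (A.prod A)
  have h : complexBetti.map μ[A.X] 1 = complexBetti.map (fst A.X A.X) 1 + complexBetti.map (snd A.X A.X) 1 := by
    rw [MonObj.mul_eq_mul]
    change singularCohomology.map ℂ ℂ (AlgPoints.mapContinuous (L := ℂ) (fst A.X A.X * snd A.X A.X)) 1 = _
    rw [mapContinuous_mul, singularCohomology.map_mul_one_of_field]
  change (complexBetti.map μ[A.X] 1).hom v = (complexBetti.map (fst A.X A.X) 1).hom v + (complexBetti.map (snd A.X A.X) 1).hom v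
  rw [h, ModuleCat.hom_add, LinearMap.add_apply]

/-- `pr₂^* v = m^* v - pr₁^* v` on `H¹(A(ℂ); ℂ)`. [cite: MumfordAV1970, §1 (2)] -/
theorem complexBetti_map_snd_one_eq_sub (v : complexBetti A.X 1) :
    complexBetti.map (snd A.X A.X) 1 v = complexBetti.map μ[A.X] 1 v - complexBetti.map (fst A.X A.X) 1 v := by
  rw [complexBetti_map_mul_one_apply, add_sub_cancel_left]

/-- **`Ω ∪ v = 0` for a top-degree class `Ω ∈ H^{2g}(A)` and `v ∈ H¹(A)`** (`H^{2g+1}(A(ℂ); ℂ) = 0`). [cite: HatcherAT2002, §3.3 Thm. 3.26] -/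
theorem cupProduct_top_one_eq_zero (hA : IsSmoothProjective g A.X) (Ω : complexBetti A.X (2 * g)) (v : complexBetti A.X 1) :
    cupProduct (rfl : 2 * g + 1 = 2 * g + 1) Ω v = 0 := by
  haveI := subsingleton_complexBetti hA (show 2 * g < 2 * g + 1 by omega)
  exact Subsingleton.elim _ _

/-- **THE COMMUTATION RULE.** For `Ω ∈ H^{2g}(A(ℂ); ℂ)`, `Γ = m^*Ω`, `v ∈ H¹`, `w ∈ Hᵈ`:
**`[Γ]_*(v ∪ w) = -(v ∪ [Γ]_* w)`**. Proof: `[Γ]_*(v ∪ w) = pr_{1*}(pr₂^*v ∪ pr₂^*w ∪ Γ)` and `pr₂^*v = m^*v - pr₁^*v`; the term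
`m^*v ∪ pr₂^*w ∪ m^*Ω = ± pr₂^*w ∪ m^*(Ω ∪ v) = 0`, and `pr_{1*}(pr₁^*v ∪ (pr₂^*w ∪ Γ)) = v ∪ pr_{1*}(pr₂^*w ∪ Γ)` (projection formula).
[cite: MumfordAV1970, §1 (2)] [cite: VoisinHodgeII2003, proof of Thm. 10.17 (10.7)] [cite: Fulton1998, Prop. 1.7 and §16.1] -/
theorem corrAction_pullMul_top_cup_one (hA : IsSmoothProjective g A.X) (Ω : complexBetti A.X (2 * g)) {d : ℕ}
    (v : complexBetti A.X 1) (w : complexBetti A.X d) :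
    corrAction complexOrientationFamily hA hA (rfl : d + 1 + 2 * g = d + 1 + 2 * g) (complexBetti.map μ[A.X] (2 * g) Ω)
        (cupProduct (Nat.add_comm 1 d) v w) =
      -cupProduct (Nat.add_comm 1 d) v
        (corrAction complexOrientationFamily hA hA (rfl : d + 2 * g = d + 2 * g) (complexBetti.map μ[A.X] (2 * g) Ω) w) := by
  have hμ : complexOrientationFamily.HasPoincareDuality := OrientationFamily.hasPoincareDuality _
  have hAA := IsSmoothProjective.tensor_holds hA hA
  set Γ := complexBetti.map μ[A.X] (2 * g) Ω with hΓ
  -- `m^*Ω ∪ m^*v = m^*(Ω ∪ v) = 0`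
  have hΓv : cupProduct (rfl : 2 * g + 1 = 2 * g + 1) Γ (complexBetti.map μ[A.X] 1 v) = 0 := by
    rw [hΓ, ← complexBetti.map_cupProduct, cupProduct_top_one_eq_zero A hA Ω v, map_zero]
  -- the `m^* v`-term dies
  have hT1 : cupProduct (rfl : d + 1 + 2 * g = d + 1 + 2 * g)
      (cupProduct (Nat.add_comm 1 d) (complexBetti.map μ[A.X] 1 v) (complexBetti.map (snd A.X A.X) d w)) Γ = 0 := by
    rw [cupProduct_assoc (Nat.add_comm 1 d) (rfl : d + 2 * g = d + 2 * g) (rfl : d + 1 + 2 * g = d + 1 + 2 * g)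
        (show 1 + (d + 2 * g) = d + 1 + 2 * g by omega),
      cupProduct_gradedComm_holds ℂ (ComplexPoints (A.X ⊗ A.X)) (show 1 + (d + 2 * g) = d + 1 + 2 * g by omega)
        (show d + 2 * g + 1 = d + 1 + 2 * g by omega),
      cupProduct_assoc (rfl : d + 2 * g = d + 2 * g) (rfl : 2 * g + 1 = 2 * g + 1) (show d + 2 * g + 1 = d + 1 + 2 * g by omega)
        (show d + (2 * g + 1) = d + 1 + 2 * g by omega),
      hΓv, map_zero, smul_zero]
  rw [corrAction_apply, corrAction_apply, complexBetti.map_cupProduct, complexBetti_map_snd_one_eq_sub A v, LinearMap.map_sub₂,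
    LinearMap.map_sub₂, map_sub, hT1, map_zero, zero_sub,
    cupProduct_assoc (Nat.add_comm 1 d) (rfl : d + 2 * g = d + 2 * g) (rfl : d + 1 + 2 * g = d + 1 + 2 * g)
      (show 1 + (d + 2 * g) = d + 1 + 2 * g by omega),
    complexGysin_cup hμ hAA hA (fst A.X A.X) (show 1 + (d + 2 * g) = d + 1 + 2 * g by omega)
      (corrAction_degree g (rfl : d + 1 + 2 * g = d + 1 + 2 * g)) (corrAction_degree g (rfl : d + 2 * g = d + 2 * g))
      (Nat.add_comm 1 d) v _]

/-- **`[m^*Ω]_*` ON THE ITERATED CUP PRODUCTS**: if `[m^*Ω]_* 1 = c · 1` then `[m^*Ω]_*(v₀ ∪ ⋯ ∪ v_{d-1}) = (-1)^d c · (v₀ ∪ ⋯ ∪ v_{d-1})`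
(induction on `d` with `corrAction_pullMul_top_cup_one`). [cite: MumfordAV1970, §1 (2)–(4)] [cite: VoisinHodgeII2003, proof of Thm. 10.17 (10.7)] -/
theorem corrAction_pullMul_top_cupPowOne (hA : IsSmoothProjective g A.X) (Ω : complexBetti A.X (2 * g)) {c : ℂ}
    (hc : corrAction complexOrientationFamily hA hA (rfl : 0 + 2 * g = 0 + 2 * g) (complexBetti.map μ[A.X] (2 * g) Ω)
      (singularCohomology.one ℂ (ComplexPoints A.X)) = c • singularCohomology.one ℂ (ComplexPoints A.X)) :
    ∀ (d : ℕ) (v : Fin d → complexBetti A.X 1),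
      corrAction complexOrientationFamily hA hA (rfl : d + 2 * g = d + 2 * g) (complexBetti.map μ[A.X] (2 * g) Ω)
        (cupPowOne ℂ (ComplexPoints A.X) d v) = ((-1 : ℂ) ^ d * c) • cupPowOne ℂ (ComplexPoints A.X) d v
  | 0, v => by rw [cupPowOne_zero, hc, pow_zero, one_mul]
  | d + 1, v => by
    rw [cupPowOne_succ, corrAction_pullMul_top_cup_one A hA Ω (v 0) _, corrAction_pullMul_top_cupPowOne hA Ω hc d (Fin.tail v),
      map_smul, pow_succ, ← neg_smul]
    congr 1
    ring

/-- **`[m^*Ω]_* = (-1)^{deg} · c` ON ALL OF `H^•(A(ℂ); ℂ)`.** For a top-degree class `Ω ∈ H^{2g}(A(ℂ); ℂ)` there is `c ∈ ℂ` with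
`[m^*Ω]_* x = (-1)^d c · x` for every `x ∈ Hᵈ(A(ℂ); ℂ)` and every `d` (`c` is the value on `1`; the cup products of degree-one classes
span `Hᵈ`, `H^•(A) = ⋀^• H¹`). In print: `m^*[pt]` is the class of the graph of `[-1]_A`, and `[-1]^* = (-1)^d` on `Hᵈ`.
[cite: MumfordAV1970, §1 (2)–(4)] [cite: Scholl1994ClassicalMotives, §5 (5.9.1)] [cite: Milne1999LefschetzClasses, Rem. 5.11]
[cite: VoisinHodgeII2003, proof of Thm. 10.17 (10.7)] -/
theorem exists_corrAction_pullMul_top_eq_smul (hA : IsSmoothProjective g A.X) (Ω : complexBetti A.X (2 * g)) :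
    ∃ c : ℂ, ∀ (d : ℕ) (x : complexBetti A.X d),
      corrAction complexOrientationFamily hA hA (rfl : d + 2 * g = d + 2 * g) (complexBetti.map μ[A.X] (2 * g) Ω) x =
        ((-1 : ℂ) ^ d * c) • x := by
  obtain ⟨c, hc⟩ := eq_smul_one_of_degree_zero hA
    (corrAction complexOrientationFamily hA hA (rfl : 0 + 2 * g = 0 + 2 * g) (complexBetti.map μ[A.X] (2 * g) Ω)
      (singularCohomology.one ℂ (ComplexPoints A.X)))
  refine ⟨c, fun d ↦ ?_⟩
  have key := corrAction_pullMul_top_cupPowOne A hA Ω hc d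
  intro x
  have hx : x ∈ Submodule.span ℂ (Set.range (cupPowOne ℂ (ComplexPoints A.X) d)) := by
    rw [abelianVarietyCohomologyExteriorH1_holds.span_range_cupPowOne A d]; exact Submodule.mem_top
  induction hx using Submodule.span_induction with
  | mem x hx =>
    obtain ⟨v, rfl⟩ := hx
    exact key v
  | zero => rw [map_zero, smul_zero]
  | add x y _ _ hx hy => rw [map_add, hx, hy, smul_add]
  | smul a x _ hx => rw [map_smul, hx, smul_comm]

end TopClass

end Summit.HodgeConjecture.HodgeConjecture.Ring2.AbelianAll

end
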